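import Summits.KontsevichZagierPeriods.KontsevichZagierPeriods.Theses.OctahedralSymmetry
import Summits.KontsevichZagierPeriods.KontsevichZagierPeriods.Theorems.OctahedralSymmetryQuarterDiscFaceWeightTwoSteps
import Summits.KontsevichZagierPeriods.KontsevichZagierPeriods.Theorems.OctahedralSymmetryQuarterDiscFaceWeightTwoCone

/-!
# `QuarterDiscFaceWeightTwo` (stmt-KontsevichZagierPeriods-9437, route OctahedralSymmetry)

The item: for representations `r₁ = [Δ₂, 1/(t₀(1 + t₁²))]` (value Catalan's `G`),
`r₂ = [Δ₂, 2t₁/((1 + t₀²)(1 + t₁²))]` (value `(π/2) log 2 − G`) on the open ordered simplex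
`Δ₂ = {1 > t₀ > t₁ > 0}` and `r₃ = [(0,1)², 2/((1 + t₀²)(1 + t₁))]` (value `(π/2) log 2`),
`[r₁] + [r₂] − [r₃] ∈ KZ.relations` — the smallest quarter-disc face of the octahedral symmetry of
`ℙ¹ ∖ {0, ∞, ±1, ±i}`: the imaginary part of the weight-two iterated integral `I(e₀ e₋₁)` along the
segment `[0, i]` equals that along `[0, 1]` followed by the arc `ρ` from `1` to `i`.

Proof (a chain of Kontsevich–Zagier moves; no transcendental function is ever an integrand or a
primitive): `step_one` (`[S] − [T]`: Green with rider for `Im dz/(1 + λz)` on the quarter disc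
`z = rρ(s)`), `step_two` (`[T] − [R] − [M]`: Green with rider for `(2/(1+s²)) Re dw/(1 + w)` on the
sector `w = r'ρ(sμ)`), the cone substitution `t₁ = t₀x₁` (`cube_to_simplex`) turning
`S = [[0,1]², 1/(1 + (x₀x₁)²)]` into `r₁` and `M = [[0,1]², −2x₀²x₁/((1 + x₀²)(1 + x₀²x₁²))]` into
`−r₂`, and the restriction of `R = [[0,1]², 2/((1 + x₀²)(1 + x₁))]` to the open square `r₃` (null
boundary). Values: `S = T = G = 0.91596…`, `R = (π/2) log 2 = 1.08879…`, `M = G − (π/2) log 2`.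

References: M. Kontsevich, D. Zagier, *Periods* (2001), §1.2; J. Zhao, *Multiple polylogarithm
values at roots of unity*, C. R. Acad. Sci. Paris 346 (2008), §4; K. C. Au, arXiv:2201.01676, §5.
-/

noncomputable section

open Set MeasureTheory MvPolynomial
open Literature.NumberTheory.Transcendental Literature.NumberTheory.Transcendental.KZ
open Literature.ModelTheory.ExponentialFields (IsSemialgebraic)
open Summit.KontsevichZagierPeriods.OctahedralSymmetry.QuarterDiscFace

namespace Summit.KontsevichZagierPeriods.OctahedralSymmetry

/-- **`QuarterDiscFaceWeightTwo`** (item stmt-KontsevichZagierPeriods-9437 of route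
KontsevichZagierPeriods/OctahedralSymmetry): `[Δ₂, 1/(t₀(1+t₁²))] + [Δ₂, 2t₁/((1+t₀²)(1+t₁²))] −
[(0,1)², 2/((1+t₀²)(1+t₁))] ∈ KZ.relations`, i.e. `G + ((π/2) log 2 − G) − (π/2) log 2 = 0` inside
Kontsevich–Zagier's rules: two Green formulas with a rider (`step_one`, `step_two`), two cone
substitutions (`cube_to_simplex`) and one restriction to the open square.
[cite: KontsevichZagier2001, §1.2] -/
theorem quarterDiscFaceWeightTwo_proof :
    Summit.KontsevichZagierPeriods.KontsevichZagierPeriods.Theses.OctahedralSymmetry.QuarterDiscFaceWeightTwo := by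
  intro r₁ r₂ r₃ hd₁ hi₁ hd₂ hi₂ hd₃ hi₃
  obtain ⟨S, T, hSd, hSi, hTd, hTi, hST⟩ := step_one
  obtain ⟨T', R, M, hT'd, hT'i, hRd, hRi, hMd, hMi, hTRM⟩ := step_two
  -- the base interval and the closed-fibre simplex band of the cone substitution
  set G₁ : Set (Fin 1 → ℝ) := {y | 0 < y 0 ∧ y 0 < 1} with hG₁
  have hG₁s : IsSemialgebraic ℚ G₁ := isSemialgebraic_unitInterval_fin_one
  have h0s : IsSemialgebraicFunOn ℚ G₁ (fun _ => (0 : ℝ)) := by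
    simpa using isSemialgebraicFunOn_ratCast hG₁s 0
  have hbs : IsSemialgebraicFunOn ℚ G₁ (fun y => y 0) := isSemialgebraicFunOn_apply hG₁s 0
  have hBs : IsSemialgebraic ℚ (KZlog.band G₁ (fun _ => (0 : ℝ)) (fun y => y 0)) :=
    KZlog.isSemialgebraic_band h0s hbs
  have memB : ∀ t : Fin 2 → ℝ, t ∈ KZlog.band G₁ (fun _ => (0 : ℝ)) (fun y => y 0) ↔
      (0 < t 0 ∧ t 0 < 1) ∧ 0 ≤ t 1 ∧ t 1 ≤ t 0 := fun t => Iff.rfl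
  -- (i) the arc terms of the two steps agree
  have hTT' : of T - of T' ∈ relations := by
    refine of_sub_of_mem_relations_of_eqOn (by rw [hTd, hT'd]) fun z hz => ?_
    rw [hTd] at hz
    rw [hTi hz, hT'i hz]
  -- (ii) `S` is `r₁` after the cone substitution `t₁ = x₀ x₁`
  have hS : of S - of r₁ ∈ relations := by
    refine cube_to_simplex (f := fun z => 1 / (1 + (z 0 * z 1) ^ 2))
      (g := fun t => 1 / (t 0 * (1 + t 1 ^ 2))) S r₁ hSd hSi hd₁ hi₁ ?_ ?_
    · refine (isSemialgebraicFunOn_aeval_div_aeval hBs (1 : MvPolynomial (Fin 2) ℚ)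
        (X 0 * (1 + X 1 ^ 2)) ?_).congr ?_
      · intro t ht
        rw [memB] at ht
        have h1 : t 0 ≠ 0 := ht.1.1.ne'
        have h2 : (1 : ℝ) + t 1 ^ 2 ≠ 0 := by positivity
        simp [h1, h2]
      · intro t _
        simp
    · intro z h0 _ _ _
      have h1 : (1 : ℝ) + (z 0 * z 1) ^ 2 ≠ 0 := by positivity
      have h2 : z 0 ≠ 0 := h0.ne'
      simp only [Matrix.cons_val_zero, Matrix.cons_val_one]
      field_simp
  -- (iii) `M` is `−r₂` after the cone substitution
  have hM : of M - of r₂.neg ∈ relations := by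
    refine cube_to_simplex (f := fun z => -(2 * z 0 ^ 2 * z 1 / ((1 + z 0 ^ 2) * (1 + z 0 ^ 2 * z 1 ^ 2))))
      (g := fun t => -(2 * t 1 / ((1 + t 0 ^ 2) * (1 + t 1 ^ 2)))) M r₂.neg hMd hMi
      (by rw [IntegralRep.domain_neg, hd₂]) (fun t ht => ?_) ?_ ?_
    · rw [IntegralRep.integrand_neg, Pi.neg_apply, hi₂ ht]
    · refine (isSemialgebraicFunOn_aeval_div_aeval hBs (-(2 * X 1) : MvPolynomial (Fin 2) ℚ)
        ((1 + X 0 ^ 2) * (1 + X 1 ^ 2)) ?_).congr ?_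
      · intro t _
        have h1 : (1 : ℝ) + t 0 ^ 2 ≠ 0 := by positivity
        have h2 : (1 : ℝ) + t 1 ^ 2 ≠ 0 := by positivity
        simp [h1, h2]
      · intro t _
        simp [neg_div]
    · intro z h0 _ _ _
      have h1 : (1 : ℝ) + z 0 ^ 2 ≠ 0 := by positivity
      have h2 : (1 : ℝ) + z 0 ^ 2 * z 1 ^ 2 ≠ 0 := by positivity
      have h3 : (1 : ℝ) + (z 0 * z 1) ^ 2 ≠ 0 := by positivity
      simp only [Matrix.cons_val_zero, Matrix.cons_val_one]
      field_simp
  have hneg : of r₂ + of r₂.neg ∈ relations :=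
    of_add_of_mem_relations_of_eqOn_neg rfl fun _ _ => rfl
  -- (iv) `R` restricted to the open square is `r₃`
  have hR : of R - of r₃ ∈ relations := by
    have hEsub : r₃.domain ⊆ R.domain := by
      rw [hd₃, hRd]
      exact fun t ht i => ⟨(ht i).1.le, (ht i).2.le⟩
    have hnull : volume (R.domain \ r₃.domain) = 0 := by
      have hplane : ∀ (i : Fin 2) (c : ℝ), volume {z : Fin 2 → ℝ | z i = c} = 0 := fun i c => by
        rw [volume_pi]
        exact Measure.pi_hyperplane _ _ _
      have hcov : R.domain \ r₃.domain ⊆ ⋃ i : Fin 2, ({z | z i = 0} ∪ {z | z i = 1}) := by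
        rw [hRd, hd₃]
        rintro t ⟨ht, ht'⟩
        simp only [mem_setOf_eq, not_forall] at ht'
        obtain ⟨i, hi⟩ := ht'
        refine mem_iUnion.2 ⟨i, ?_⟩
        simp only [mem_union, mem_setOf_eq]
        have h := ht i
        by_contra hc
        push Not at hc
        exact hi ⟨lt_of_le_of_ne h.1 (Ne.symm hc.1), lt_of_le_of_ne h.2 hc.2⟩
      exact measure_mono_null hcov (measure_iUnion_null fun i =>
        measure_union_null (hplane i 0) (hplane i 1))
    have h1 := R.of_sub_of_restrict_mem_relations r₃.isSemialgebraic_domain hEsub hnull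
    have h2 : of (R.restrict r₃.domain r₃.isSemialgebraic_domain hEsub) - of r₃ ∈ relations := by
      refine of_sub_of_mem_relations_of_eqOn rfl fun t ht => ?_
      change R.integrand t = r₃.integrand t
      rw [hRi (hRd ▸ hEsub ht), hi₃ ht]
    have : of R - of r₃ = (of R - of (R.restrict r₃.domain r₃.isSemialgebraic_domain hEsub)) +
        (of (R.restrict r₃.domain r₃.isSemialgebraic_domain hEsub) - of r₃) := by abel
    rw [this]
    exact relations.add_mem h1 h2
  -- assembly
  have : of r₁ + of r₂ - of r₃ = -(of S - of r₁) + (of S - of T) + (of T - of T') +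
      (of T' - of R - of M) + (of R - of r₃) + (of M - of r₂.neg) + (of r₂ + of r₂.neg) := by abel
  rw [this]
  exact relations.add_mem (relations.add_mem (relations.add_mem (relations.add_mem
    (relations.add_mem (relations.add_mem (relations.neg_mem hS) hST) hTT') hTRM) hR) hM) hneg

end Summit.KontsevichZagierPeriods.OctahedralSymmetry

end
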